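import Summits.CriticalPhenomena.PercolationContinuityZ3.Theorems.PercNearOneGluingNoHeavyLowerTailQuantGapReductions
import HarnessLib

/-!
# `NoHeavyLowerTail` (stmt-CriticalPhenomena-4575) — the SHARPENED GUARDED CAUCHY–SCHWARZ LAW (STCS2) at a single
# observer closes the crux (typed reduction)

Lemma factory #8 (`prim-lf-8`, gen 3), 2026-08-19.  `μ = prodBernoulli w` on `Fin n`, relays `A`, observer `o ∉ A`,
level `j`, `π(v) = {x ∈ A : v ↔ x}`, `N = |π(o)|`, `S_x = μ(|π(x)| ≤ j)`, champion `c` (`S_a ≤ S_c` for all `a`),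
runner-up value `S₂ = max_{a ≠ c} S_a`.

The ttrl2 census `run/shared/lean/ttrl/tcs/README.md` (request of `prim-hp-5`, completed 2026-08-19T07:55Z) found the
guarded T-form inequality TCS `μ(c ↮ S, 1 ≤ M_S ≤ j) ≤ μ(c ↮ S, M_S ≥ 1, |π(c)| ≤ j)` violation-free (40.9 M exhaustive
pairs n ≤ 7, 96 000 climbs n ≤ 9) and an empirically exact SHARPENING with the runner-up weight,

  **STCS2:**  `S_c · μ(c ↮ S, 1 ≤ M_S ≤ j) ≤ S₂ · μ(c ↮ S, M_S ≥ 1, |π(c)| ≤ j)`   (0 failures in 8.98 M unique-champion pairs).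

For a single observer `S = {o}` this is the T-form (attached, "pre-FKG") sharpening of the TWO-LEVEL PACKING inequality QP
of this seat's batch 2 (`run/shared/lean/prim/prim-lf-8/CANDIDATES.md` A4; typed in
`…QuantGapReductions.lean` as the hypothesis of `noHeavyLowerTail_of_twoLevelPacking`):
`S_c · μ(o ↮ c, 1 ≤ N ≤ j) ≤ S₂ · μ(o ↮ c, |π(c)| ≤ j)` — STCS2 has the smaller right-hand event `{N ≥ 1} ∩ {|π(c)| ≤ j}`.
Hence STCS2 at `|S| = 1` ⇒ QP ⇒ QG ⇒ CIL ⇒ `stub_cumulativeIsolation` ⇒ `NoHeavyLowerTail`, all typed.  This file records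
the first implication and the composite, so that the TCS/STCS2 route (coordinator relay 2026-08-19T07:47Z: `prim-hp-5`
pivots to it) has its closing target in the tree:

* `SharpTCS.twoLevelPacking_of_sharpTCS` — one instance: the STCS2 inequality at `(w, A, o, c, j, t)` (with any
  admissible runner-up bound `t`, `S_a ≤ t ≤ S_c` for `a ≠ c`, `0 ≤ t`) implies the QP inequality at the same data.
* `noHeavyLowerTail_of_sharpTCS` — **STCS2 for single observers (all weighted graphs, all `A`, `o ∉ A`, champions `c`,
  levels `j`, admissible `t`) implies `NoHeavyLowerTail`.**

The hypothesis is written with a free runner-up bound `t` exactly like `hQP` of `noHeavyLowerTail_of_twoLevelPacking`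
(for `t = S₂` it is STCS2 verbatim; larger `t` only weakens it).  No definitions, no named facts, no sorries.
-/

noncomputable section

namespace Summit.CriticalPhenomena.PercolationContinuityZ3.Theorems

open MeasureTheory Set Literature.Probability.LatticeModels Literature.Probability.Percolation
open scoped Classical BigOperators

namespace SharpTCS

variable {n : ℕ}

/-- **STCS2 ⇒ QP at one instance.**  If `0 ≤ t` and
`μ(o ↮ c, 1 ≤ N ≤ j) · S_c ≤ μ(o ↮ c, 1 ≤ N ∧ |π(c)| ≤ j) · t` (the sharpened guarded Cauchy–Schwarz law with
runner-up bound `t`), then `μ(o ↮ c, 1 ≤ N ≤ j) · S_c ≤ μ(o ↮ c, |π(c)| ≤ j) · t` (two-level packing QP): the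
right-hand event only grows when the attachment requirement `1 ≤ N` is dropped. [this file] -/
theorem twoLevelPacking_of_sharpTCS (w : Sym2 (Fin n) → unitInterval) (A : Finset (Fin n)) (o c : Fin n) (j : ℕ)
    (t : ℝ) (ht : 0 ≤ t)
    (hST : (prodBernoulli w).real ((openConn o c : Set (BondConfig (Fin n)))ᶜ ∩
          {ω | 1 ≤ (A.filter fun x => ω ∈ openConn o x).card ∧
            (A.filter fun x => ω ∈ openConn o x).card ≤ j}) *
        (prodBernoulli w).real {ω : BondConfig (Fin n) | (A.filter fun x => ω ∈ openConn c x).card ≤ j} ≤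
      (prodBernoulli w).real ((openConn o c : Set (BondConfig (Fin n)))ᶜ ∩
          {ω | 1 ≤ (A.filter fun x => ω ∈ openConn o x).card ∧
            (A.filter fun x => ω ∈ openConn c x).card ≤ j}) * t) :
    (prodBernoulli w).real ((openConn o c : Set (BondConfig (Fin n)))ᶜ ∩
          {ω | 1 ≤ (A.filter fun x => ω ∈ openConn o x).card ∧
            (A.filter fun x => ω ∈ openConn o x).card ≤ j}) *
        (prodBernoulli w).real {ω : BondConfig (Fin n) | (A.filter fun x => ω ∈ openConn c x).card ≤ j} ≤
      (prodBernoulli w).real ((openConn o c : Set (BondConfig (Fin n)))ᶜ ∩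
          {ω | (A.filter fun x => ω ∈ openConn c x).card ≤ j}) * t := by
  refine hST.trans (mul_le_mul_of_nonneg_right ?_ ht)
  refine measureReal_mono ?_ (measure_ne_top _ _)
  intro ω hω
  exact ⟨hω.1, hω.2.2⟩

end SharpTCS

/-- **STCS2 at a single observer closes the crux.**  If for every weighted graph on `Fin n`, every relay set `A`,
observer `o ∉ A`, relay `c ∈ A`, level `j` and every `t ≥ 0` with `S_a ≤ t` for all relays `a ≠ c` and `t ≤ S_c`
(so `c` is a champion and `t` an admissible runner-up bound) the sharpened guarded Cauchy–Schwarz law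
`μ(o ↮ c, 1 ≤ N ≤ j) · S_c ≤ μ(o ↮ c, 1 ≤ N ∧ |π(c)| ≤ j) · t` holds, then `NoHeavyLowerTail`.
(Via `SharpTCS.twoLevelPacking_of_sharpTCS` and `noHeavyLowerTail_of_twoLevelPacking`: STCS2 ⇒ QP ⇒ QG ⇒ CIL ⇒ crux.)
[this file] -/
theorem noHeavyLowerTail_of_sharpTCS
    (hST : ∀ (n : ℕ) (w : Sym2 (Fin n) → unitInterval) (A : Finset (Fin n)) (o c : Fin n) (j : ℕ) (t : ℝ),
      o ∉ A → c ∈ A → 0 ≤ t →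
      (∀ a ∈ A, a ≠ c →
        (prodBernoulli w).real {ω : BondConfig (Fin n) | (A.filter fun x => ω ∈ openConn a x).card ≤ j} ≤ t) →
      t ≤ (prodBernoulli w).real {ω : BondConfig (Fin n) | (A.filter fun x => ω ∈ openConn c x).card ≤ j} →
      (prodBernoulli w).real ((openConn o c : Set (BondConfig (Fin n)))ᶜ ∩
          {ω | 1 ≤ (A.filter fun x => ω ∈ openConn o x).card ∧
            (A.filter fun x => ω ∈ openConn o x).card ≤ j}) *
        (prodBernoulli w).real {ω : BondConfig (Fin n) | (A.filter fun x => ω ∈ openConn c x).card ≤ j} ≤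
      (prodBernoulli w).real ((openConn o c : Set (BondConfig (Fin n)))ᶜ ∩
          {ω | 1 ≤ (A.filter fun x => ω ∈ openConn o x).card ∧
            (A.filter fun x => ω ∈ openConn c x).card ≤ j}) * t) :
    Summit.CriticalPhenomena.PercolationContinuityZ3.Theses.PercNearOneGluing.NoHeavyLowerTail :=
  noHeavyLowerTail_of_twoLevelPacking fun n w A o c j t ho hc ht hdom htc =>
    SharpTCS.twoLevelPacking_of_sharpTCS w A o c j t ht (hST n w A o c j t ho hc ht hdom htc)

end Summit.CriticalPhenomena.PercolationContinuityZ3.Theorems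

end
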